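import Summits.ABC.ABC.Theses.DefiniteXi
import Summits.ABC.ABC.Theorems.DefiniteXiPolyFreyDegree
import Summits.ABC.ABC.Theorems.DefiniteXiFreyModularityCDT
import Summits.ABC.ABC.Theorems.DefiniteXiFreyValuationBoundShape
import HarnessLib

/-!
# Route DefiniteXi — item `PolyFreyDegree` (stmt-ABC-2026): the weak rung on its named-fact trust base

`Summit.ABC.ABC.Theses.DefiniteXi.PolyFreyDegree` (absolute `A, C` with SOME parametrisation datum
of every Frey curve `E_(a,b)` at its conductor level of degree `≤ C · N^A`) is held on four route
items (planner hold 2026-08-16: `XiBound` stmt-ABC-11336, `DefiniteRTControlPrime` stmt-ABC-11338,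
`FreyValuationBound` stmt-ABC-14677, `FreyModularity` stmt-ABC-11340) through the landed glue
`Summit.ABC.ABC.Theorems.DefiniteXiPolyFreyDegree.polyFreyDegree_of_xiBound_of_valuationBound`.
Two of the four are now discharged in the tree MODULO NAMED LITERATURE FACTS:

* the valuation input (the dropped item stmt-ABC-14677, rev 10 of the route) from ANY Baker-shape
  effective abc bound `Literature.Barriers.ABC.BakerShapeBound θ m`
  (`Summit.ABC.ABC.Theorems.DefiniteXiFreyValuationBound.freyValuationBound_of_bakerShapeBound`;
  Stewart–Tijdeman 1986 is `(15, 0)`, Stewart–Yu 2001 is `(1/3, 3)`);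
* `FreyModularity` from Conrad–Diamond–Taylor 1999 Thm. 7.1.2
  (`Literature.NumberTheory.Automorphic.BCDT.CDT_theorem_7_1_2`, applicable since `9 ∤ N_{E_(a,b)}`)
  and the commensurability of `Λ_f` and `Λ_E`
  (`Literature.NumberTheory.EllipticCurves.ModularForms.IsNewformOf.exists_maninConstant_ne_zero`)
  (`Summit.ABC.ABC.Theorems.freyModularity_of_CDT_theorem_7_1_2`).

This file composes them (no new mathematics): modulo those three published facts the item is
EXACTLY the pair of route cruxes `XiBound ∧ DefiniteRTControlPrime`
(`polyFreyDegree_of_xiBound_of_definiteRTControlPrime`), and modulo the two modularity facts alone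
it is EQUIVALENT to the polynomial bound for minimal-degree data
(`polyFreyDegree_iff_minimalBound_of_modularity`) — the residual open problem (polynomial Szpiro on
Frey curves in disguise; Murty 1999 Thm 1, Pasten 2024 §3).  The unconditional necessity
`PolyFreyDegree → FreyModularity` is `freyModularity_of_polyFreyDegree` (same namespace).

References: B. Conrad, F. Diamond, R. Taylor, JAMS 12 (1999) Thm. 7.1.2; C. L. Stewart,
R. Tijdeman, Monatsh. Math. 102 (1986) Thm 1; S. Takahashi, JNT 90 (2001) Thm 2.3/3.8;
M. R. Murty, Proc. Sympos. Pure Math. 66.1 (1999) Thm 1.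
-/

-- `Summit.ABC.ABC` is the mandated summit-side namespace (CONVENTIONS §2); the duplicate is deliberate.
set_option linter.dupNamespace false

noncomputable section

namespace Summit.ABC.ABC.Theorems.DefiniteXiPolyFreyDegree

open Literature.NumberTheory.EllipticCurves
open Literature.NumberTheory.EllipticCurves.ModularForms
open Literature.NumberTheory.Automorphic
open Literature.Barriers.ABC
open Summit.ABC.ABC.Theses.DefiniteXi

/-- **The weak rung on its named-fact trust base.**  Any Baker-shape effective abc bound
`log c ≤ κ rad(abc)^θ (log rad)^m` (Stewart–Tijdeman 1986 / Stewart–Yu 2001), CDT 1999 Thm. 7.1.2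
and the commensurability of the Eichler–Shimura and Néron lattices, together with the two route
cruxes `XiBound` (stmt-ABC-11336) and `DefiniteRTControlPrime` (stmt-ABC-11338), give
`PolyFreyDegree`: the landed weak glue `polyFreyDegree_of_xiBound_of_valuationBound` with its
valuation input from `freyValuationBound_of_bakerShapeBound` and its existence input from
`freyModularity_of_CDT_theorem_7_1_2`. [folklore] -/
theorem polyFreyDegree_of_xiBound_of_definiteRTControlPrime {θ : ℝ} {m : ℕ}
    (hBS : BakerShapeBound θ m) (h712 : BCDT.CDT_theorem_7_1_2)
    (ha : IsNewformOf.exists_maninConstant_ne_zero)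
    (hXi : XiBound) (hRT : DefiniteRTControlPrime) : PolyFreyDegree :=
  polyFreyDegree_of_xiBound_of_valuationBound hXi hRT
    (DefiniteXiFreyValuationBound.freyValuationBound_of_bakerShapeBound hBS)
    (freyModularity_of_CDT_theorem_7_1_2 h712 ha)

/-- The same with Stewart–Tijdeman 1986 (`stewartTijdeman1986_upperBound = BakerShapeBound 15 0`)
as the transcendence input. [folklore] -/
theorem polyFreyDegree_of_xiBound_of_definiteRTControlPrime_of_stewartTijdeman
    (hST : stewartTijdeman1986_upperBound) (h712 : BCDT.CDT_theorem_7_1_2)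
    (ha : IsNewformOf.exists_maninConstant_ne_zero)
    (hXi : XiBound) (hRT : DefiniteRTControlPrime) : PolyFreyDegree :=
  polyFreyDegree_of_xiBound_of_definiteRTControlPrime (θ := 15) (m := 0) hST h712 ha hXi hRT

/-- **Modulo modularity the item is the minimal-degree bound.**  Given CDT 1999 Thm. 7.1.2 and the
commensurability fact (which together give `FreyModularity`), `PolyFreyDegree` holds iff every
MINIMAL-degree datum `D` of `E_(a,b)` at its conductor level satisfies `deg D ≤ C N^A` for absolute
`A, C` — the split `polyFreyDegree_iff_freyModularity_and_minimalBound` with its first conjunct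
discharged.  This right-hand side is the open residual of the item (polynomial Szpiro on Frey curves
in disguise). [folklore] -/
theorem polyFreyDegree_iff_minimalBound_of_modularity (h712 : BCDT.CDT_theorem_7_1_2)
    (ha : IsNewformOf.exists_maninConstant_ne_zero) :
    PolyFreyDegree ↔
      ∃ A C : ℝ, ∀ a b : ℤ, IsCoprime a b → a * b * (a + b) ≠ 0 → ∀ (N : ℕ) [NeZero N],
        (freyCurve a b).conductorNorm ℤ = N →
        ∀ D : ModularParametrizationData (freyCurve a b) N,
          (∀ D' : ModularParametrizationData (freyCurve a b) N, D.deg ≤ D'.deg) →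
            (D.deg : ℝ) ≤ C * (N : ℝ) ^ A := by
  rw [polyFreyDegree_iff_freyModularity_and_minimalBound]
  exact ⟨fun h ↦ h.2, fun h ↦ ⟨freyModularity_of_CDT_theorem_7_1_2 h712 ha, h⟩⟩

end Summit.ABC.ABC.Theorems.DefiniteXiPolyFreyDegree

end
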